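import Literature.NumberTheory.DiophantineGeometry.MordellEquationMinusTwo
import Literature.NumberTheory.QuadraticFields.GaussianPrimary
import Mathlib.NumberTheory.Zsqrtd.QuadraticReciprocity
import Mathlib.NumberTheory.LegendreSymbol.QuadraticChar.Basic
import HarnessLib

/-!
# Primary elements of `ℤ[√-2]` (Rajwade's normalisation modulo `4√-2`) and the multiplicative sums
# `S(m) = ∑_{x primary, N(x) = m} x`

Topic `Literature/NumberTheory/QuadraticFields`, namespace `Literature.NumberTheory.QuadraticFields.SqrtNegTwoPrimary`.
The `ℤ[√-2]`-twin of `GaussianPrimary` (`ℤ[i]`, `x ≡ 1 (mod 2 + 2i)`), filed for the Hecke-theta dictionary of the CM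
elliptic curves with `j = 8000` (`y² = x³ + 4n x² + 2n² x`, CM by `ℤ[√-2]`; Rajwade 1968):
`a_m(B_n) = (−n/m) · S(m)` with `S(m) = ∑_{x primary, N(x) = m} x` (the sequel
`EllipticCurves/SqrtTwoTwistHeckeCoefficients`).  Everything here is proved (Mathlib, the tree's Euclidean structure on
`(ℤ√(-2))` from `DiophantineGeometry/MordellEquationMinusTwo`, and the generic recursion of `GaussianPrimary`).

## Content

* `IsPrimary x` — **Rajwade's normalisation** (Proc. Cambridge Philos. Soc. 64 (1968); Silverberg, Contemp. Math. 521
  (2010), Thm. 2.7): `x = a + b√-2` is *primary* if `x ≡ 1, 3, 1 ± √-2, 3 ± √-2, 5 + 2√-2` or `7 + 2√-2 (mod 4√-2)`, i.e.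
  `(a mod 8, b mod 4) ∈ H = {(1,0),(3,0),(1,±1),(3,±1),(5,2),(7,2)}`, read here as: `a ≡ 1, 3 (mod 8)` and `b ≢ 2 (mod 4)`, or
  `a ≡ 5, 7 (mod 8)` and `b ≡ 2 (mod 4)` — stated on the residues `(a, b) mod 8` (`primaryRes`, decidable).  `H` is a subgroup
  of index `2` of `(ℤ[√-2]/4√-2)^×` not containing `−1` and stable under conjugation, so: products and conjugates of primary
  elements are primary (`IsPrimary.mul/.pow/.star`), and every `x` with odd real part (= odd norm = prime to `√-2`) has
  EXACTLY ONE primary associate `±x` (`primary x`; `primary_mul`, `primary_neg`, `primary_star`; the units are `±1`).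
* `primaryNormEq m`, `primarySum m = S(m)`: `S(1) = 1`, `S(m) = 0` for even `m`, **`S(mm') = S(m)S(m')` for coprime `m, m'`**
  (`primarySum_mul_of_coprime`, the bijection `(y, z) ↦ yz` via Bézout in the Euclidean domain `ℤ[√-2]`, for an arbitrary
  weight: `sum_primaryNormEq_mul_of_coprime`);
* inert primes `p ≡ 5, 7 (mod 8)` (`−2` a non-residue): `p` is prime in `ℤ[√-2]` (`prime_natCast_of_mod_eight`), the elements of
  norm `p^k` are `±p^{k/2}`, `primary p` is `p` or `−p` (`p ≡ 1, 3` resp. `5, 7 (mod 8)`: here always `−p`), and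
  **`S(p^{2j}) = (−p)^j`, `S(p^{2j+1}) = 0`** (`primarySum_pow_of_mod_eight_inert`);
* split primes `p ≡ 1, 3 (mod 8)`: **there is a primary `π` with `N(π) = p`** (`exists_isPrimary_norm_eq`: `−2` is a square mod
  `p`, so `p ∣ c² + 2 = (c + √-2)(c − √-2)` is not prime in the UFD `ℤ[√-2]`, hence a norm — Fermat's `p = a² + 2b²`), `π ∤ π̄`,
  the elements of norm `p^k` are `±π^j π̄^{k−j}`, and **`S(p^k) = ∑_{j ≤ k} π^j π̄^{k−j}`** (`primarySum_pow_of_split`).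

## References
* A. R. Rajwade, *Arithmetic on curves with complex multiplication by √−2*, Proc. Cambridge Philos. Soc. 64 (1968), 659–672
  (the congruence classes modulo `4√-2`). [Rajwade1968]
* A. Silverberg, *Group order formulas for reductions of CM elliptic curves*, Contemp. Math. 521 (2010), Thm. 2.7 (Rajwade's theorem:
  `#E(𝔽_p) = p + 1 − (a/p)(π + π̄)`, `π ≡ 1, 3, 1 ± √-2, 3 ± √-2, 5 + 2√-2, 7 + 2√-2 (mod 4√-2)`). [Silverberg2010]
* K. Ireland, M. Rosen, *A Classical Introduction to Modern Number Theory*, 2nd ed., GTM 84 (1990), Ch. 1 Ex. 36 (`ℤ[√-2]` is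
  Euclidean), Ch. 9 §7 Lemmas 6–8 (primary elements, the model followed here), Ch. 18 §6 (proof of Theorem 7). [IrelandRosen1990]

## Mathlib / tree search
Tree: `ZsqrtdNegTwo.{norm_eq, norm_pos_of_ne_zero, units_eq}` and `EuclideanDomain ((ℤ√(-2)))` (`MordellEquationMinusTwo`);
`GaussianPrimary.{sum_pow_mul_pow_rec, eq_of_dvd_of_mul_eq, not_prime_mul_self}` (generic lemmas reused).  Mathlib:
`Zsqrtd.{norm_mul, norm_eq_mul_conj, norm_conj, norm_eq_one_iff', norm_nonneg, norm_natCast, re_mul, im_mul}`,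
`ZMod.exists_sq_eq_neg_two_iff`, `Irreducible.prime` (UFD from the Euclidean structure).  `lean search 'primary.*√\\(-2\\)|SqrtNegTwo'`:
nothing.
-/

namespace Literature.NumberTheory.QuadraticFields

namespace SqrtNegTwoPrimary

open Zsqrtd Literature.NumberTheory.DiophantineGeometry.ZsqrtdNegTwo

/-! ### Norm, units and parity in `ℤ[√-2]` -/

/-- `N(a + b√-2) = a² + 2b²` (as `a·a + 2·b·b`). [cite: IrelandRosen1990, Ch. 1, Ex. 36] -/
theorem norm_def' (x : (ℤ√(-2))) : x.norm = x.re * x.re + 2 * (x.im * x.im) := by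
  rw [Zsqrtd.norm_def]; ring

/-- The norm on `ℤ[√-2]` is nonnegative. [cite: IrelandRosen1990, Ch. 1, Ex. 36] -/
theorem norm_nonneg' (x : (ℤ√(-2))) : 0 ≤ x.norm := Zsqrtd.norm_nonneg (by norm_num) x

/-- `N(x) = 0 ↔ x = 0` in `ℤ[√-2]`. [cite: IrelandRosen1990, Ch. 1, Ex. 36] -/
theorem norm_eq_zero_iff' (x : (ℤ√(-2))) : x.norm = 0 ↔ x = 0 := by
  constructor
  · intro h
    by_contra hx
    have := norm_pos_of_ne_zero hx
    omega
  · rintro rfl; simp [Zsqrtd.norm_def]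

/-- The units of `ℤ[√-2]` are `±1`. [cite: IrelandRosen1990, §17.10] -/
theorem eq_of_isUnit {u : (ℤ√(-2))} (hu : IsUnit u) : u = 1 ∨ u = -1 :=
  units_eq hu.unit

/-- `N(x) ≡ re x (mod 2)`. [cite: IrelandRosen1990, Ch. 9 §7, Lemma 6 (analogue)] -/
theorem norm_emod_two (x : (ℤ√(-2))) : x.norm % 2 = x.re % 2 := by
  rw [norm_def', Int.add_emod, Int.mul_emod x.re]
  have h1 := Int.emod_two_eq_zero_or_one x.re
  rcases h1 with h1 | h1 <;> simp [h1, Int.mul_emod_right]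

/-- `N(x^k) = N(x)^k`. [cite: IrelandRosen1990, Ch. 1, Ex. 36] -/
theorem norm_pow' (x : (ℤ√(-2))) (k : ℕ) : (x ^ k).norm = x.norm ^ k :=
  map_pow Zsqrtd.normMonoidHom x k

/-- `x ∣ N(x)` in `ℤ[√-2]` (`N(x) = x x̄`). [cite: IrelandRosen1990, Ch. 1, Ex. 36] -/
theorem self_dvd_norm (x : (ℤ√(-2))) : x ∣ (x.norm : (ℤ√(-2))) :=
  ⟨star x, Zsqrtd.norm_eq_mul_conj x⟩

/-- The norm, cast into `ℤ[√-2]`, is `x · x̄`. [cite: IrelandRosen1990, Ch. 1, Ex. 36] -/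
theorem cast_norm_eq (x : (ℤ√(-2))) : ((x.norm : ℤ) : (ℤ√(-2))) = x * star x := Zsqrtd.norm_eq_mul_conj x

/-- If `a ∣ b` in `ℤ[√-2]` then `N(a) ∣ N(b)`. [cite: IrelandRosen1990, Ch. 1, Ex. 36] -/
theorem norm_dvd_norm {a b : (ℤ√(-2))} (h : a ∣ b) : a.norm ∣ b.norm := by
  obtain ⟨c, rfl⟩ := h
  exact ⟨c.norm, Zsqrtd.norm_mul a c⟩

/-- Coprime naturals are coprime in `ℤ[√-2]`. [cite: IrelandRosen1990, Ch. 1, Ex. 36] -/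
theorem isCoprime_natCast {m m' : ℕ} (h : m.Coprime m') : IsCoprime (m : (ℤ√(-2))) (m' : (ℤ√(-2))) := by
  have := (Nat.isCoprime_iff_coprime.mpr h).map (Int.castRingHom (ℤ√(-2)))
  simpa using this

/-- `star p = p` for a natural number `p`. [cite: IrelandRosen1990, Ch. 1, Ex. 36] -/
theorem star_natCast (p : ℕ) : star (p : (ℤ√(-2))) = p := by
  ext <;> simp

/-- `p ∣ star x → p ∣ x` for a natural number `p`. [cite: IrelandRosen1990, Ch. 1, Ex. 36] -/
theorem natCast_dvd_of_dvd_star {p : ℕ} {x : (ℤ√(-2))} (h : (p : (ℤ√(-2))) ∣ star x) : (p : (ℤ√(-2))) ∣ x := by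
  obtain ⟨c, hc⟩ := h
  refine ⟨star c, ?_⟩
  have := congrArg star hc
  rwa [star_star, star_mul, star_natCast, mul_comm] at this

/-! ### Primary elements: Rajwade's classes modulo `4√-2` -/

/-- The subgroup `H` of `(ℤ[√-2]/4√-2)^×` on residues `(a, b) mod 8` of `a + b√-2`: `a ≡ 1, 3 (mod 8)` and `b ≢ 2 (mod 4)`, or
`a ≡ 5, 7 (mod 8)` and `b ≡ 2 (mod 4)` — the classes `1, 3, 1 ± √-2, 3 ± √-2, 5 + 2√-2, 7 + 2√-2 (mod 4√-2)` of Rajwade's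
theorem. [cite: Silverberg2010, Thm. 2.7] [cite: Rajwade1968, Theorem 1] -/
def primaryRes (r s : ZMod 8) : Prop :=
  ((r = 1 ∨ r = 3) ∧ s ≠ 2 ∧ s ≠ 6) ∨ ((r = 5 ∨ r = 7) ∧ (s = 2 ∨ s = 6))

/-- `primaryRes` is decidable. [cite: Silverberg2010, Thm. 2.7] -/
instance : ∀ r s, Decidable (primaryRes r s) := fun _ _ ↦ inferInstanceAs (Decidable (_ ∨ _))

/-- An element `x = a + b√-2 ∈ ℤ[√-2]` is *primary* (Rajwade's normalisation) if
`x ≡ 1, 3, 1 ± √-2, 3 ± √-2, 5 + 2√-2, 7 + 2√-2 (mod 4√-2)`, i.e. `primaryRes (a mod 8) (b mod 8)`.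
[cite: Silverberg2010, Thm. 2.7] [cite: Rajwade1968, Theorem 1] -/
def IsPrimary (x : (ℤ√(-2))) : Prop := primaryRes (x.re : ZMod 8) (x.im : ZMod 8)

/-- Primarity is decidable. [cite: Silverberg2010, Thm. 2.7] -/
instance : DecidablePred IsPrimary := fun _ ↦ inferInstanceAs (Decidable (primaryRes _ _))

/-- `H` is closed under the multiplication of `ℤ[√-2]` read modulo `8`:
`(r₁ + s₁√-2)(r₂ + s₂√-2) = (r₁r₂ − 2s₁s₂) + (r₁s₂ + s₁r₂)√-2`. [cite: Silverberg2010, Thm. 2.7] -/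
theorem primaryRes_mul {r₁ s₁ r₂ s₂ : ZMod 8} (h₁ : primaryRes r₁ s₁) (h₂ : primaryRes r₂ s₂) :
    primaryRes (r₁ * r₂ + -2 * s₁ * s₂) (r₁ * s₂ + s₁ * r₂) := by
  revert r₁ s₁ r₂ s₂
  decide

/-- `H` is stable under conjugation `s ↦ −s`. [cite: Silverberg2010, Thm. 2.7] -/
theorem primaryRes_neg_snd {r s : ZMod 8} (h : primaryRes r s) : primaryRes r (-s) := by
  revert r s; decide

/-- `H` has index `2` in the odd residues: for `r` odd, one of `(r, s)`, `(−r, −s)` lies in `H`.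
[cite: Silverberg2010, Thm. 2.7] -/
theorem primaryRes_or_neg {r s : ZMod 8} (hr : r = 1 ∨ r = 3 ∨ r = 5 ∨ r = 7) :
    primaryRes r s ∨ primaryRes (-r) (-s) := by
  revert r s; decide

/-- `−1 ∉ H`: `(r, s)` and `(−r, −s)` are never both in `H`. [cite: Silverberg2010, Thm. 2.7] -/
theorem primaryRes_not_and_neg {r s : ZMod 8} : ¬ (primaryRes r s ∧ primaryRes (-r) (-s)) := by
  revert r s; decide

/-- No `(r, s)` with `r` even lies in `H`. [cite: Silverberg2010, Thm. 2.7] -/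
theorem primaryRes_odd {r s : ZMod 8} (h : primaryRes r s) : r = 1 ∨ r = 3 ∨ r = 5 ∨ r = 7 := by
  revert r s; decide

/-- `(1, 0) ∈ H`. [cite: Silverberg2010, Thm. 2.7] -/
theorem primaryRes_one : primaryRes 1 0 := by decide

/-- `a ↦ a mod 8` factors through `ZMod 8`. [cite: IrelandRosen1990, Ch. 5 §1] -/
theorem intCast_zmod_eight (a : ℤ) : (a : ZMod 8) = ((a % 8 : ℤ) : ZMod 8) := by
  have h := ZMod.intCast_mod a 8
  simp only [Nat.cast_ofNat] at h
  exact h.symm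

/-- The residue of an odd integer mod `8` is `1, 3, 5` or `7`. [cite: IrelandRosen1990, Ch. 5 §1] -/
theorem cast_zmod_eight_of_odd {a : ℤ} (ha : a % 2 = 1) :
    (a : ZMod 8) = 1 ∨ (a : ZMod 8) = 3 ∨ (a : ZMod 8) = 5 ∨ (a : ZMod 8) = 7 := by
  have h8 : a % 8 = 1 ∨ a % 8 = 3 ∨ a % 8 = 5 ∨ a % 8 = 7 := by omega
  rw [intCast_zmod_eight]
  rcases h8 with h | h | h | h <;> rw [h] <;> decide

/-- An integer whose residue mod `8` is `1, 3, 5` or `7` is odd. [cite: IrelandRosen1990, Ch. 5 §1] -/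
theorem odd_of_cast_zmod_eight {a : ℤ} (h : (a : ZMod 8) = 1 ∨ (a : ZMod 8) = 3 ∨ (a : ZMod 8) = 5 ∨ (a : ZMod 8) = 7) :
    a % 2 = 1 := by
  rw [intCast_zmod_eight] at h
  have h0 : 0 ≤ a % 8 := Int.emod_nonneg _ (by norm_num)
  have h1 : a % 8 < 8 := Int.emod_lt_of_pos _ (by norm_num)
  have key : ∀ t : ℤ, 0 ≤ t → t < 8 →
      ((t : ZMod 8) = 1 ∨ (t : ZMod 8) = 3 ∨ (t : ZMod 8) = 5 ∨ (t : ZMod 8) = 7) → t % 2 = 1 := by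
    intro t ht0 ht8 ht
    interval_cases t <;> simp_all (config := { decide := true })
  have := key (a % 8) h0 h1 h
  omega

/-- `1` is primary. [cite: Silverberg2010, Thm. 2.7] -/
theorem isPrimary_one : IsPrimary 1 := by
  unfold IsPrimary; simpa using primaryRes_one

/-- A primary element has odd real part (it is prime to `√-2`). [cite: Silverberg2010, Thm. 2.7] -/
theorem IsPrimary.odd {x : (ℤ√(-2))} (hx : IsPrimary x) : x.re % 2 = 1 :=
  odd_of_cast_zmod_eight (primaryRes_odd hx)

/-- A primary element has odd norm. [cite: Silverberg2010, Thm. 2.7] -/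
theorem IsPrimary.norm_odd {x : (ℤ√(-2))} (hx : IsPrimary x) : x.norm % 2 = 1 := by
  rw [norm_emod_two]; exact hx.odd

/-- A primary element is nonzero. [cite: Silverberg2010, Thm. 2.7] -/
theorem IsPrimary.ne_zero {x : (ℤ√(-2))} (hx : IsPrimary x) : x ≠ 0 := by
  rintro rfl
  have := IsPrimary.odd hx
  simp at this

/-- Products of primary elements are primary (`H` is a subgroup). [cite: Silverberg2010, Thm. 2.7] -/
theorem IsPrimary.mul {x y : (ℤ√(-2))} (hx : IsPrimary x) (hy : IsPrimary y) : IsPrimary (x * y) := by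
  unfold IsPrimary at hx hy ⊢
  have h := primaryRes_mul hx hy
  simp only [Zsqrtd.re_mul, Zsqrtd.im_mul, Int.cast_add, Int.cast_mul, Int.cast_neg, Int.cast_ofNat]
  convert h using 2

/-- Powers of a primary element are primary. [cite: Silverberg2010, Thm. 2.7] -/
theorem IsPrimary.pow {x : (ℤ√(-2))} (hx : IsPrimary x) (k : ℕ) : IsPrimary (x ^ k) := by
  induction k with
  | zero => simpa using isPrimary_one
  | succ k ih => rw [pow_succ]; exact ih.mul hx

/-- `star` preserves primarity (`H` is stable under conjugation). [cite: Silverberg2010, Thm. 2.7] -/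
theorem IsPrimary.star {x : (ℤ√(-2))} (hx : IsPrimary x) : IsPrimary (star x) := by
  unfold IsPrimary at hx ⊢
  simp only [Zsqrtd.re_star, Zsqrtd.im_star, Int.cast_neg]
  exact primaryRes_neg_snd hx

/-- Primarity of `−x`: the residues are negated. [cite: Silverberg2010, Thm. 2.7] -/
theorem isPrimary_neg_iff (x : (ℤ√(-2))) : IsPrimary (-x) ↔ primaryRes (-(x.re : ZMod 8)) (-(x.im : ZMod 8)) := by
  unfold IsPrimary
  simp only [Zsqrtd.re_neg, Zsqrtd.im_neg, Int.cast_neg]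

/-- **One of `x`, `−x` is primary** when `re x` is odd (`[odd residues : H] = 2`). [cite: Silverberg2010, Thm. 2.7] -/
theorem isPrimary_or_neg {x : (ℤ√(-2))} (hx : x.re % 2 = 1) : IsPrimary x ∨ IsPrimary (-x) := by
  rw [isPrimary_neg_iff]
  exact primaryRes_or_neg (cast_zmod_eight_of_odd hx)

/-- **`x` and `−x` are not both primary** (`−1 ∉ H`). [cite: Silverberg2010, Thm. 2.7] -/
theorem not_isPrimary_and_neg (x : (ℤ√(-2))) : ¬ (IsPrimary x ∧ IsPrimary (-x)) := by
  rw [isPrimary_neg_iff]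
  exact primaryRes_not_and_neg

/-- **Uniqueness of the primary associate**: if `x` and `u x` are both primary for a unit `u`, then `u = 1`.
[cite: IrelandRosen1990, Ch. 9 §7, Lemma 7 (analogue)] -/
theorem IsPrimary.eq_one_of_isUnit {x u : (ℤ√(-2))} (hx : IsPrimary x) (hu : IsUnit u)
    (hux : IsPrimary (u * x)) : u = 1 := by
  rcases eq_of_isUnit hu with rfl | rfl
  · rfl
  · exfalso
    rw [neg_one_mul] at hux
    exact not_isPrimary_and_neg x ⟨hx, hux⟩

/-- Two associated primary elements are equal. [cite: IrelandRosen1990, Ch. 9 §7, Lemma 7 (analogue)] -/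
theorem IsPrimary.eq_of_associated {y y' : (ℤ√(-2))} (hy : IsPrimary y) (hy' : IsPrimary y')
    (h : Associated y y') : y = y' := by
  obtain ⟨u, rfl⟩ := h
  have hu : (u : (ℤ√(-2))) = 1 := hy.eq_one_of_isUnit u.isUnit (by rwa [mul_comm])
  rw [hu, mul_one]

/-- The *primary associate* of `x`: the unique primary one of `±x` if `re x` is odd, and `0` otherwise (`x` divisible by
`√-2`). [cite: IrelandRosen1990, Ch. 9 §7, Lemma 7 (analogue)] -/
def primary (x : (ℤ√(-2))) : (ℤ√(-2)) :=
  if IsPrimary x then x else if IsPrimary (-x) then -x else 0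

/-- A primary element is its own primary associate. [cite: IrelandRosen1990, Ch. 9 §7, Lemma 7 (analogue)] -/
theorem primary_of_isPrimary {x : (ℤ√(-2))} (h : IsPrimary x) : primary x = x := if_pos h

/-- For `re x` odd, `primary x` is primary. [cite: IrelandRosen1990, Ch. 9 §7, Lemma 7 (analogue)] -/
theorem isPrimary_primary {x : (ℤ√(-2))} (h : x.re % 2 = 1) : IsPrimary (primary x) := by
  unfold primary
  split_ifs with h1 h2
  · exact h1
  · exact h2
  · exfalso
    rcases isPrimary_or_neg h with h3 | h3
    · exact h1 h3
    · exact h2 h3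

/-- For `re x` even there is no primary associate: `primary x = 0`. [cite: IrelandRosen1990, Ch. 9 §7, Lemma 7 (analogue)] -/
theorem primary_eq_zero_of_even {x : (ℤ√(-2))} (h : x.re % 2 = 0) : primary x = 0 := by
  unfold primary
  split_ifs with h1 h2
  · exfalso; have := h1.odd; omega
  · exfalso; have := h2.odd; simp only [Zsqrtd.re_neg] at this; omega
  · rfl

/-- `primary x = u x` for a unit `u`, when `re x` is odd. [cite: IrelandRosen1990, Ch. 9 §7, Lemma 7 (analogue)] -/
theorem exists_isUnit_primary_eq {x : (ℤ√(-2))} (h : x.re % 2 = 1) :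
    ∃ u : (ℤ√(-2)), IsUnit u ∧ primary x = u * x := by
  unfold primary
  split_ifs with h1 h2
  · exact ⟨1, isUnit_one, (one_mul x).symm⟩
  · exact ⟨-1, isUnit_one.neg, by ring⟩
  · exfalso
    rcases isPrimary_or_neg h with h3 | h3
    · exact h1 h3
    · exact h2 h3

/-- `primary x` is associated to `x` (for `re x` odd). [cite: IrelandRosen1990, Ch. 9 §7, Lemma 7 (analogue)] -/
theorem associated_primary {x : (ℤ√(-2))} (h : x.re % 2 = 1) : Associated x (primary x) := by
  obtain ⟨u, hu, hux⟩ := exists_isUnit_primary_eq h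
  exact ⟨hu.unit, by rw [hux, mul_comm]; rfl⟩

/-- Parity of `re` is that of the norm, hence multiplicative. [cite: IrelandRosen1990, Ch. 9 §7, Lemma 6 (analogue)] -/
theorem parity_mul (x y : (ℤ√(-2))) : (x * y).re % 2 = x.re % 2 * (y.re % 2) % 2 := by
  rw [← norm_emod_two, ← norm_emod_two, ← norm_emod_two, Zsqrtd.norm_mul, Int.mul_emod]

/-- Associated elements have the same parity. [cite: IrelandRosen1990, Ch. 9 §7, Lemma 6 (analogue)] -/
theorem parity_eq_of_associated {x y : (ℤ√(-2))} (h : Associated x y) : x.re % 2 = y.re % 2 := by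
  obtain ⟨u, rfl⟩ := h
  rw [← norm_emod_two, ← norm_emod_two, Zsqrtd.norm_mul,
    (Zsqrtd.norm_eq_one_iff' (by norm_num) _).mpr u.isUnit, mul_one]

/-- **The primary associate is characterised by primarity and association.** [cite: IrelandRosen1990, Ch. 9 §7, Lemma 7 (analogue)] -/
theorem primary_eq_of_associated {x y : (ℤ√(-2))} (h : Associated x y) (hy : IsPrimary y) : primary x = y := by
  have hx : x.re % 2 = 1 := by rw [parity_eq_of_associated h]; exact hy.odd
  exact (isPrimary_primary hx).eq_of_associated hy ((associated_primary hx).symm.trans h)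

/-- `primary` is constant on associate classes. [cite: IrelandRosen1990, Ch. 9 §7, Lemma 7 (analogue)] -/
theorem primary_eq_primary_of_associated {x y : (ℤ√(-2))} (h : Associated x y) : primary x = primary y := by
  by_cases hy : y.re % 2 = 1
  · exact primary_eq_of_associated (h.trans (associated_primary hy)) (isPrimary_primary hy)
  · rw [primary_eq_zero_of_even (x := y) (by omega), primary_eq_zero_of_even]
    rw [parity_eq_of_associated h]; omega

/-- **`primary` is multiplicative**: `primary (x y) = primary x · primary y`. [cite: IrelandRosen1990, Ch. 9 §7, Lemma 7 (analogue)] -/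
theorem primary_mul (x y : (ℤ√(-2))) : primary (x * y) = primary x * primary y := by
  by_cases hx : x.re % 2 = 1
  · by_cases hy : y.re % 2 = 1
    · refine primary_eq_of_associated ?_ ((isPrimary_primary hx).mul (isPrimary_primary hy))
      exact (associated_primary hx).mul_mul (associated_primary hy)
    · rw [primary_eq_zero_of_even (x := y) (by omega), mul_zero, primary_eq_zero_of_even]
      rw [parity_mul]
      have : y.re % 2 = 0 := by omega
      rw [this]; simp
  · rw [primary_eq_zero_of_even (x := x) (by omega), zero_mul, primary_eq_zero_of_even]
    rw [parity_mul]
    have : x.re % 2 = 0 := by omega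
    rw [this]; simp

/-- The primary associate of a unit is `1`. [cite: IrelandRosen1990, Ch. 9 §7, Lemma 7 (analogue)] -/
theorem primary_of_isUnit {u : (ℤ√(-2))} (hu : IsUnit u) : primary u = 1 :=
  primary_eq_of_associated (associated_one_iff_isUnit.mpr hu) isPrimary_one

/-- `primary 1 = 1`. [cite: IrelandRosen1990, Ch. 9 §7, Lemma 7 (analogue)] -/
@[simp] theorem primary_one : primary 1 = 1 := primary_of_isUnit isUnit_one

/-- `primary (u x) = primary x` for a unit `u`. [cite: IrelandRosen1990, Ch. 9 §7, Lemma 7 (analogue)] -/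
theorem primary_isUnit_mul {u : (ℤ√(-2))} (hu : IsUnit u) (x : (ℤ√(-2))) : primary (u * x) = primary x := by
  rw [primary_mul, primary_of_isUnit hu, one_mul]

/-- `primary (-x) = primary x`. [cite: IrelandRosen1990, Ch. 9 §7, Lemma 7 (analogue)] -/
@[simp] theorem primary_neg (x : (ℤ√(-2))) : primary (-x) = primary x := by
  have h : -x = -1 * x := by ring
  rw [h, primary_isUnit_mul isUnit_one.neg]

/-- `primary (x^k) = (primary x)^k`. [cite: IrelandRosen1990, Ch. 9 §7, Lemma 7 (analogue)] -/
theorem primary_pow (x : (ℤ√(-2))) (k : ℕ) : primary (x ^ k) = primary x ^ k := by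
  induction k with
  | zero => simp
  | succ k ih => rw [pow_succ, primary_mul, ih, pow_succ]

/-- `primary (star x) = star (primary x)`. [cite: IrelandRosen1990, Ch. 9 §7, Lemma 7 (analogue)] -/
theorem primary_star (x : (ℤ√(-2))) : primary (star x) = star (primary x) := by
  by_cases hx : x.re % 2 = 1
  · refine primary_eq_of_associated ?_ (isPrimary_primary hx).star
    obtain ⟨u, hu, hux⟩ := exists_isUnit_primary_eq hx
    exact ⟨hu.star.unit, by rw [IsUnit.unit_spec, hux, star_mul]⟩
  · have hx' : x.re % 2 = 0 := by omega
    rw [primary_eq_zero_of_even hx', star_zero, primary_eq_zero_of_even]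
    simp only [Zsqrtd.re_star]; omega

/-- The norm of the primary associate. [cite: IrelandRosen1990, Ch. 9 §7, Lemma 7 (analogue)] -/
theorem norm_primary {x : (ℤ√(-2))} (h : x.re % 2 = 1) : (primary x).norm = x.norm := by
  obtain ⟨u, hu, hux⟩ := exists_isUnit_primary_eq h
  rw [hux, Zsqrtd.norm_mul, (Zsqrtd.norm_eq_one_iff' (by norm_num) u).mpr hu, one_mul]

/-! ### The sums `S(m)` of primary elements of norm `m` -/

/-- The (finite) set of primary elements of `ℤ[√-2]` of norm `m`. [cite: IrelandRosen1990, Ch. 18 §6, proof of Theorem 7 (analogue)] -/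
noncomputable def primaryNormEq (m : ℕ) : Finset (ℤ√(-2)) :=
  (((Finset.Icc (-(m : ℤ)) m) ×ˢ (Finset.Icc (-(m : ℤ)) m)).image
    fun p : ℤ × ℤ ↦ (⟨p.1, p.2⟩ : (ℤ√(-2)))).filter fun x ↦ x.norm = m ∧ IsPrimary x

/-- `x ∈ primaryNormEq m ↔ N(x) = m ∧ x primary`. [cite: IrelandRosen1990, Ch. 18 §6, proof of Theorem 7 (analogue)] -/
theorem mem_primaryNormEq {m : ℕ} {x : (ℤ√(-2))} :
    x ∈ primaryNormEq m ↔ x.norm = m ∧ IsPrimary x := by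
  simp only [primaryNormEq, Finset.mem_filter, Finset.mem_image, Finset.mem_product,
    Finset.mem_Icc, Prod.exists, and_iff_right_iff_imp]
  rintro ⟨h, -⟩
  refine ⟨x.re, x.im, ⟨?_, ?_⟩, rfl⟩
  · have h1 : (x.re.natAbs : ℤ) ≤ m := by
      rw [← h, norm_def']
      nlinarith [Int.natAbs_le_self_sq x.re, mul_self_nonneg x.im]
    constructor <;> omega
  · have h1 : (x.im.natAbs : ℤ) ≤ m := by
      rw [← h, norm_def']
      nlinarith [Int.natAbs_le_self_sq x.im, mul_self_nonneg x.re, mul_self_nonneg x.im]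
    constructor <;> omega

/-- **`S(m) = ∑_{x primary, N(x) = m} x`**, the `m`-th coefficient of the Hecke `L`-series `∑_{x primary} x N(x)^{-s}` of `ℚ(√-2)`
attached to `y² = x(x² − 4x + 2)`. [cite: Rajwade1968, Theorem 1] [cite: Silverberg2010, Thm. 2.7] -/
noncomputable def primarySum (m : ℕ) : (ℤ√(-2)) := ∑ x ∈ primaryNormEq m, x

/-- The primary elements of norm `1`: only `1`. [cite: IrelandRosen1990, Ch. 18 §6, proof of Theorem 7 (analogue)] -/
theorem primaryNormEq_one : primaryNormEq 1 = {1} := by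
  ext x
  rw [mem_primaryNormEq, Finset.mem_singleton, Nat.cast_one]
  constructor
  · rintro ⟨hn, hp⟩
    have hu : IsUnit x := (Zsqrtd.norm_eq_one_iff' (by norm_num) x).mp hn
    rcases eq_of_isUnit hu with rfl | rfl
    · rfl
    · exfalso
      exact not_isPrimary_and_neg 1 ⟨isPrimary_one, hp⟩
  · rintro rfl
    exact ⟨by simp [Zsqrtd.norm_def], isPrimary_one⟩

/-- `S(1) = 1`. [cite: IrelandRosen1990, Ch. 18 §6, proof of Theorem 7 (analogue)] -/
@[simp] theorem primarySum_one : primarySum 1 = 1 := by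
  rw [primarySum, primaryNormEq_one, Finset.sum_singleton]

/-- No primary element has even norm. [cite: IrelandRosen1990, Ch. 18 §6, proof of Theorem 7 (analogue)] -/
theorem primaryNormEq_eq_empty_of_even {m : ℕ} (hm : 2 ∣ m) : primaryNormEq m = ∅ := by
  ext x
  simp only [mem_primaryNormEq, Finset.notMem_empty, iff_false, not_and]
  intro hx hp
  have := hp.norm_odd
  omega

/-- `S(m) = 0` for even `m`. [cite: IrelandRosen1990, Ch. 18 §6, proof of Theorem 7 (analogue)] -/
theorem primarySum_of_even {m : ℕ} (hm : 2 ∣ m) : primarySum m = 0 := by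
  rw [primarySum, primaryNormEq_eq_empty_of_even hm, Finset.sum_empty]

/-! ### Multiplicativity: the bijection `(y, z) ↦ yz` for coprime norms -/

/-- **Weighted multiplicativity of sums over primary elements**: for coprime `m, m'`, `(y, z) ↦ yz` is a bijection from pairs of
primary elements of norms `m`, `m'` onto the primary elements of norm `mm'` (unique factorisation in the Euclidean domain
`ℤ[√-2]`), so `Σ_{N x = mm'} f(x) = Σ_{N y = m, N z = m'} f(yz)` for every weight `f`.
[cite: IrelandRosen1990, Ch. 9 §7 Lemma 8; Ch. 18 §6, proof of Theorem 7 (analogue for ℤ[√-2])] -/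
theorem sum_primaryNormEq_mul_of_coprime {M : Type*} [AddCommMonoid M] (f : (ℤ√(-2)) → M) {m m' : ℕ}
    (h : m.Coprime m') :
    ∑ x ∈ primaryNormEq (m * m'), f x = ∑ p ∈ primaryNormEq m ×ˢ primaryNormEq m', f (p.1 * p.2) := by
  symm
  have hcop : IsCoprime (m : (ℤ√(-2))) (m' : (ℤ√(-2))) := isCoprime_natCast h
  have hdvd : ∀ {y : (ℤ√(-2))} {k : ℕ}, y.norm = k → y ∣ (k : (ℤ√(-2))) := fun {y k} hy ↦ by
    have := self_dvd_norm y
    rwa [hy, Int.cast_natCast] at this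
  refine Finset.sum_bij (fun p _ ↦ p.1 * p.2) ?_ ?_ ?_ (fun _ _ ↦ rfl)
  · -- maps into
    rintro ⟨y, z⟩ hp
    rw [Finset.mem_product] at hp
    obtain ⟨hy, hyp⟩ := mem_primaryNormEq.mp hp.1
    obtain ⟨hz, hzp⟩ := mem_primaryNormEq.mp hp.2
    refine mem_primaryNormEq.mpr ⟨?_, hyp.mul hzp⟩
    rw [Zsqrtd.norm_mul, hy, hz, Nat.cast_mul]
  · -- injective
    rintro ⟨y, z⟩ hp ⟨y', z'⟩ hp' hyz
    simp only at hyz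
    rw [Finset.mem_product] at hp hp'
    obtain ⟨hy, hyp⟩ := mem_primaryNormEq.mp hp.1
    obtain ⟨hz, hzp⟩ := mem_primaryNormEq.mp hp.2
    obtain ⟨hy', hyp'⟩ := mem_primaryNormEq.mp hp'.1
    obtain ⟨hz', hzp'⟩ := mem_primaryNormEq.mp hp'.2
    have hc : IsCoprime y z' :=
      (hcop.of_isCoprime_of_dvd_left (hdvd hy)).of_isCoprime_of_dvd_right (hdvd hz')
    have h1 : y ∣ y' := hc.dvd_of_dvd_mul_right ⟨z, by rw [← hyz, mul_comm]⟩
    obtain ⟨w, hw⟩ := h1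
    have hm0 : (m : ℤ) ≠ 0 := by
      rw [← hy]; exact (norm_pos_of_ne_zero hyp.ne_zero).ne'
    have hwn : w.norm = 1 := by
      have := congrArg Zsqrtd.norm hw
      rw [Zsqrtd.norm_mul, hy, hy'] at this
      exact (mul_right_inj' hm0).mp (by rw [← this, mul_one])
    have hwu : IsUnit w := (Zsqrtd.norm_eq_one_iff' (by norm_num) w).mp hwn
    have hyy' : y = y' := hyp.eq_of_associated hyp' ⟨hwu.unit, by rw [IsUnit.unit_spec, hw]⟩
    subst hyy'
    have hzz' : z = z' := mul_left_cancel₀ hyp.ne_zero hyz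
    subst hzz'
    rfl
  · -- surjective
    intro x hx
    obtain ⟨hxn, hxp⟩ := mem_primaryNormEq.mp hx
    have hm0 : m ≠ 0 := by
      rintro rfl
      rw [zero_mul, Nat.cast_zero, norm_eq_zero_iff'] at hxn
      exact hxp.ne_zero hxn
    have hm0' : m' ≠ 0 := by
      rintro rfl
      rw [mul_zero, Nat.cast_zero, norm_eq_zero_iff'] at hxn
      exact hxp.ne_zero hxn
    set g := EuclideanDomain.gcd x (m : (ℤ√(-2))) with hg
    set g' := EuclideanDomain.gcd x (m' : (ℤ√(-2))) with hg'
    have hgx : g ∣ x := EuclideanDomain.gcd_dvd_left _ _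
    have hgm : g ∣ (m : (ℤ√(-2))) := EuclideanDomain.gcd_dvd_right _ _
    have hg'x : g' ∣ x := EuclideanDomain.gcd_dvd_left _ _
    have hg'm : g' ∣ (m' : (ℤ√(-2))) := EuclideanDomain.gcd_dvd_right _ _
    have hcg : IsCoprime g g' :=
      (hcop.of_isCoprime_of_dvd_left hgm).of_isCoprime_of_dvd_right hg'm
    have h1 : g * g' ∣ x := hcg.mul_dvd hgx hg'x
    have hxmm : x ∣ (m : (ℤ√(-2))) * m' := by
      have := hdvd hxn
      rwa [Nat.cast_mul] at this
    have h2 : x ∣ g * g' := by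
      rw [hg, hg', EuclideanDomain.gcd_eq_gcd_ab x (m : (ℤ√(-2))), EuclideanDomain.gcd_eq_gcd_ab x (m' : (ℤ√(-2)))]
      set a := EuclideanDomain.gcdA x (m : (ℤ√(-2)))
      set b := EuclideanDomain.gcdB x (m : (ℤ√(-2)))
      set a' := EuclideanDomain.gcdA x (m' : (ℤ√(-2)))
      set b' := EuclideanDomain.gcdB x (m' : (ℤ√(-2)))
      have : (x * a + (m : (ℤ√(-2))) * b) * (x * a' + (m' : (ℤ√(-2))) * b') =
          x * (a * (x * a' + (m' : (ℤ√(-2))) * b') + (m : (ℤ√(-2))) * b * a') + (m : (ℤ√(-2))) * m' * (b * b') := by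
        ring
      rw [this]
      exact dvd_add (dvd_mul_right _ _) (hxmm.mul_right _)
    have hassoc : Associated x (g * g') := associated_of_dvd_dvd h2 h1
    -- parities
    have hgodd : g.re % 2 = 1 := by
      have h3 := norm_dvd_norm hgx
      rw [← norm_emod_two]
      have hx2 : x.norm % 2 = 1 := hxp.norm_odd
      rcases Int.emod_two_eq_zero_or_one g.norm with h0 | h0
      · exfalso
        obtain ⟨c, hc⟩ := h3
        rw [hc, Int.mul_emod, h0] at hx2
        simp at hx2
      · exact h0
    have hg'odd : g'.re % 2 = 1 := by
      have h3 := norm_dvd_norm hg'x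
      rw [← norm_emod_two]
      have hx2 : x.norm % 2 = 1 := hxp.norm_odd
      rcases Int.emod_two_eq_zero_or_one g'.norm with h0 | h0
      · exfalso
        obtain ⟨c, hc⟩ := h3
        rw [hc, Int.mul_emod, h0] at hx2
        simp at hx2
      · exact h0
    -- norms
    have hng : g.norm.natAbs ∣ m := by
      have h3 : g.norm.natAbs ∣ m * m := by
        have := norm_dvd_norm hgm
        rw [Zsqrtd.norm_natCast] at this
        exact Int.natAbs_dvd_natAbs.mpr this |>.trans (by simp [Int.natAbs_mul])
      have h4 : g.norm.natAbs ∣ m * m' := by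
        have := norm_dvd_norm hgx
        rw [hxn] at this
        have := Int.natAbs_dvd_natAbs.mpr this
        rwa [Int.natAbs_natCast] at this
      have h5 := Nat.dvd_gcd h3 h4
      rwa [Nat.gcd_mul_left, h.gcd_eq_one, mul_one] at h5
    have hng' : g'.norm.natAbs ∣ m' := by
      have h3 : g'.norm.natAbs ∣ m' * m' := by
        have := norm_dvd_norm hg'm
        rw [Zsqrtd.norm_natCast] at this
        exact Int.natAbs_dvd_natAbs.mpr this |>.trans (by simp [Int.natAbs_mul])
      have h4 : g'.norm.natAbs ∣ m * m' := by
        have := norm_dvd_norm hg'x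
        rw [hxn] at this
        have := Int.natAbs_dvd_natAbs.mpr this
        rwa [Int.natAbs_natCast] at this
      have h5 := Nat.dvd_gcd h4 h3
      rwa [Nat.gcd_mul_right, h.gcd_eq_one, one_mul] at h5
    have hN : g.norm.natAbs * g'.norm.natAbs = m * m' := by
      obtain ⟨u, hu⟩ := hassoc
      have := congrArg Zsqrtd.norm hu
      rw [Zsqrtd.norm_mul, Zsqrtd.norm_mul, (Zsqrtd.norm_eq_one_iff' (by norm_num) _).mpr u.isUnit,
        mul_one, hxn] at this
      have := congrArg Int.natAbs this
      rwa [Int.natAbs_mul, Int.natAbs_natCast, eq_comm] at this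
    obtain ⟨hgm_eq, hg'm_eq⟩ := GaussianPrimary.eq_of_dvd_of_mul_eq hng hng' hN hm0 hm0'
    refine ⟨(primary g, primary g'), ?_, ?_⟩
    · rw [Finset.mem_product]
      refine ⟨mem_primaryNormEq.mpr ⟨?_, isPrimary_primary hgodd⟩,
        mem_primaryNormEq.mpr ⟨?_, isPrimary_primary hg'odd⟩⟩
      · rw [norm_primary hgodd, ← hgm_eq, Int.natAbs_of_nonneg (norm_nonneg' g)]
      · rw [norm_primary hg'odd, ← hg'm_eq, Int.natAbs_of_nonneg (norm_nonneg' g')]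
    · simp only
      rw [← primary_mul, ← primary_eq_primary_of_associated hassoc, primary_of_isPrimary hxp]

/-- **`S(m m') = S(m) S(m')` for coprime `m, m'`.** [cite: IrelandRosen1990, Ch. 18 §6, proof of Theorem 7 (analogue for ℤ[√-2])] -/
theorem primarySum_mul_of_coprime {m m' : ℕ} (h : m.Coprime m') :
    primarySum (m * m') = primarySum m * primarySum m' := by
  rw [primarySum, primarySum, primarySum, Finset.sum_mul_sum, ← Finset.sum_product']
  exact sum_primaryNormEq_mul_of_coprime (fun x ↦ x) h

/-! ### Inert primes `p ≡ 5, 7 (mod 8)` -/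

/-- An element of prime norm is prime in `ℤ[√-2]`. [cite: IrelandRosen1990, Ch. 1, Ex. 36] -/
theorem prime_of_norm_eq_prime {π : (ℤ√(-2))} {p : ℕ} (hp : p.Prime) (h : π.norm = p) : Prime π := by
  have hirr : Irreducible π := by
    refine irreducible_iff.mpr ⟨fun hu ↦ ?_, fun a b hab ↦ ?_⟩
    · have := (Zsqrtd.norm_eq_one_iff' (by norm_num) π).mpr hu
      rw [h] at this
      exact hp.ne_one (by exact_mod_cast this)
    · have hn := congrArg Zsqrtd.norm hab
      rw [Zsqrtd.norm_mul, h] at hn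
      have hn' := congrArg Int.natAbs hn
      rw [Int.natAbs_natCast, Int.natAbs_mul] at hn'
      rcases Nat.prime_mul_iff.mp (hn' ▸ hp) with ⟨-, hb⟩ | ⟨-, ha⟩
      · exact Or.inr (Zsqrtd.norm_eq_one_iff.mp hb)
      · exact Or.inl (Zsqrtd.norm_eq_one_iff.mp ha)
  exact hirr.prime

/-- If `N(x) = p` is prime then `−2` is a square modulo `p`: `a² + 2b² = p` with `p ∤ b`.
[cite: IrelandRosen1990, Ch. 5 §1 (p = a² + 2b² ⟺ p ≡ 1, 3 (mod 8))] -/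
theorem isSquare_neg_two_of_norm_eq {x : (ℤ√(-2))} {p : ℕ} [Fact p.Prime] (h : x.norm = p) :
    IsSquare (-2 : ZMod p) := by
  have hp : p.Prime := Fact.out
  have hab : (x.re : ZMod p) ^ 2 + 2 * (x.im : ZMod p) ^ 2 = 0 := by
    have : ((x.norm : ℤ) : ZMod p) = 0 := by rw [h]; simp
    rw [norm_def'] at this
    push_cast at this
    linear_combination this
  have hb : (x.im : ZMod p) ≠ 0 := by
    intro hb
    rw [hb] at hab
    have ha : (x.re : ZMod p) = 0 := by simpa using hab
    rw [ZMod.intCast_zmod_eq_zero_iff_dvd] at ha hb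
    have h2 : ((p : ℤ) ^ 2) ∣ x.norm := by
      rw [norm_def']
      exact dvd_add (by rw [pow_two]; exact mul_dvd_mul ha ha)
        (dvd_mul_of_dvd_right (by rw [pow_two]; exact mul_dvd_mul hb hb) 2)
    rw [h] at h2
    have : (p : ℤ) ^ 2 ≤ p := Int.le_of_dvd (by exact_mod_cast hp.pos) h2
    have hp2' : (2 : ℤ) ≤ p := by exact_mod_cast hp.two_le
    nlinarith
  refine ⟨(x.re : ZMod p) / (x.im : ZMod p), ?_⟩
  field_simp
  linear_combination -hab

/-- **A prime `p ≡ 5, 7 (mod 8)` stays prime in `ℤ[√-2]`** (`−2` is a non-residue, so `p` is not a norm).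
[cite: IrelandRosen1990, Ch. 5 §1 and Ch. 1 Ex. 36] -/
theorem prime_natCast_of_mod_eight {p : ℕ} [hpp : Fact p.Prime] (hp : p % 8 = 5 ∨ p % 8 = 7) :
    Prime (p : (ℤ√(-2))) := by
  have hP : p.Prime := hpp.out
  have hp2 : p ≠ 2 := by rintro rfl; norm_num at hp
  have hirr : Irreducible (p : (ℤ√(-2))) := by
    refine irreducible_iff.mpr ⟨fun hu ↦ ?_, fun a b hab ↦ ?_⟩
    · have h1 := (Zsqrtd.norm_eq_one_iff' (by norm_num) (p : (ℤ√(-2)))).mpr hu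
      rw [Zsqrtd.norm_natCast] at h1
      have h2 : (2 : ℤ) ≤ p := by exact_mod_cast hP.two_le
      nlinarith
    · have hn := congrArg Zsqrtd.norm hab
      rw [Zsqrtd.norm_natCast, Zsqrtd.norm_mul] at hn
      -- `N(a) N(b) = p²`: one of them is `1`, or both are `p`
      have ha0 := norm_nonneg' a
      have hb0 := norm_nonneg' b
      have hn' : a.norm.natAbs * b.norm.natAbs = p * p := by
        have := congrArg Int.natAbs hn
        rwa [Int.natAbs_mul, Int.natAbs_mul, Int.natAbs_natCast, eq_comm] at this
      have hdvd : a.norm.natAbs ∣ p ^ 2 := by rw [pow_two]; exact Dvd.intro _ hn'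
      obtain ⟨i, hi, hai⟩ := (Nat.dvd_prime_pow hP).mp hdvd
      interval_cases i
      · left
        rw [pow_zero] at hai
        exact Zsqrtd.norm_eq_one_iff.mp hai
      · -- `N(a) = p`: impossible
        exfalso
        rw [pow_one] at hai
        have ha : a.norm = p := by rw [← Int.natAbs_of_nonneg ha0, hai]
        have hsq := isSquare_neg_two_of_norm_eq ha
        rw [ZMod.exists_sq_eq_neg_two_iff hp2] at hsq
        omega
      · right
        rw [hai, pow_two] at hn'
        have hp0 : 0 < p * p := Nat.pos_of_ne_zero (mul_ne_zero hP.ne_zero hP.ne_zero)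
        have hb1 : b.norm.natAbs = 1 := Nat.eq_of_mul_eq_mul_left hp0 (hn'.trans (mul_one _).symm)
        exact Zsqrtd.norm_eq_one_iff.mp hb1
  exact hirr.prime

/-- `−p` is primary for `p ≡ 5, 7 (mod 8)` (and `p` is not): `χ((p)) = −p` at the inert primes.
[cite: Silverberg2010, Thm. 2.7] [cite: IrelandRosen1990, Ch. 18 §6 (analogue of χ((p)) = −p)] -/
theorem isPrimary_neg_natCast {p : ℕ} (hp : p % 8 = 5 ∨ p % 8 = 7) : IsPrimary (-(p : (ℤ√(-2)))) := by
  unfold IsPrimary primaryRes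
  simp only [Zsqrtd.re_neg, Zsqrtd.im_neg, Zsqrtd.re_natCast, Zsqrtd.im_natCast, neg_zero, Int.cast_neg,
    Int.cast_natCast, Int.cast_zero]
  have hc : ((p : ℕ) : ZMod 8) = (((p % 8 : ℕ)) : ZMod 8) := by rw [ZMod.natCast_mod]
  rw [hc]
  rcases hp with h | h <;> rw [h] <;> decide

/-- `primary p = −p` for `p ≡ 5, 7 (mod 8)`. [cite: Silverberg2010, Thm. 2.7] -/
theorem primary_natCast_of_mod_eight {p : ℕ} (hp : p % 8 = 5 ∨ p % 8 = 7) :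
    primary (p : (ℤ√(-2))) = -(p : (ℤ√(-2))) := by
  rw [← primary_neg]; exact primary_of_isPrimary (isPrimary_neg_natCast hp)

/-- **Elements of norm `p^k` at an inert prime** `p ≡ 5, 7 (mod 8)`: `k = 2j` and `x = ±p^j`.
[cite: IrelandRosen1990, Ch. 18 §6, proof of Theorem 7 (analogue)] -/
theorem associated_pow_of_norm_eq_pow_of_inert {p : ℕ} [hpp : Fact p.Prime]
    (hp : p % 8 = 5 ∨ p % 8 = 7) (k : ℕ) (x : (ℤ√(-2))) (hx : x.norm = (p : ℤ) ^ k) :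
    ∃ j : ℕ, k = 2 * j ∧ Associated x ((p : (ℤ√(-2))) ^ j) := by
  induction k using Nat.strong_induction_on generalizing x with
  | _ k ih =>
    rcases k with _ | k
    · refine ⟨0, rfl, ?_⟩
      rw [pow_zero, associated_one_iff_isUnit, ← Zsqrtd.norm_eq_one_iff' (by norm_num) x, hx, pow_zero]
    · have hprime : Prime (p : (ℤ√(-2))) := prime_natCast_of_mod_eight hp
      have hdvd : (p : (ℤ√(-2))) ∣ x * star x := by
        rw [← cast_norm_eq, hx]
        push_cast
        exact dvd_pow_self _ (Nat.succ_ne_zero k)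
      have hpx : (p : (ℤ√(-2))) ∣ x := by
        rcases hprime.dvd_or_dvd hdvd with h | h
        · exact h
        · exact natCast_dvd_of_dvd_star h
      obtain ⟨x', rfl⟩ := hpx
      rcases k with _ | k
      · exfalso
        rw [Zsqrtd.norm_mul, Zsqrtd.norm_natCast, zero_add, pow_one] at hx
        have hx0 : x' ≠ 0 := by
          rintro rfl
          rw [Zsqrtd.norm_zero, mul_zero] at hx
          exact hpp.out.ne_zero (by exact_mod_cast hx.symm)
        have h1 : 1 ≤ x'.norm := norm_pos_of_ne_zero hx0
        have hp2 : (2 : ℤ) ≤ p := by exact_mod_cast hpp.out.two_le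
        nlinarith
      · have hx' : x'.norm = (p : ℤ) ^ k := by
          rw [Zsqrtd.norm_mul, Zsqrtd.norm_natCast, pow_succ, pow_succ] at hx
          have hp0 : (p : ℤ) ≠ 0 := by exact_mod_cast hpp.out.ne_zero
          apply mul_left_cancel₀ (mul_ne_zero hp0 hp0)
          rw [hx]
          ring
        obtain ⟨j, hj, hassoc⟩ := ih k (by omega) x' hx'
        refine ⟨j + 1, by omega, ?_⟩
        rw [pow_succ, mul_comm ((p : (ℤ√(-2))) ^ j)]
        exact (Associated.refl _).mul_mul hassoc

/-- **Primary elements of norm `p^{2j}`, `p^{2j+1}` at an inert prime**: `{(−p)^j}` and `∅`.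
[cite: IrelandRosen1990, Ch. 18 §6, proof of Theorem 7 (analogue)] [cite: Silverberg2010, Thm. 2.7] -/
theorem primaryNormEq_pow_of_inert {p : ℕ} [Fact p.Prime] (hp : p % 8 = 5 ∨ p % 8 = 7) (j : ℕ) :
    primaryNormEq (p ^ (2 * j)) = {(-(p : (ℤ√(-2)))) ^ j} ∧ primaryNormEq (p ^ (2 * j + 1)) = ∅ := by
  constructor
  · refine Finset.eq_singleton_iff_unique_mem.mpr ⟨?_, fun x hx ↦ ?_⟩
    · refine mem_primaryNormEq.mpr ⟨?_, (isPrimary_neg_natCast hp).pow j⟩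
      rw [norm_pow', Zsqrtd.norm_neg, Zsqrtd.norm_natCast]
      push_cast
      ring
    · obtain ⟨hxn, hxp⟩ := mem_primaryNormEq.mp hx
      obtain ⟨j', hj', hassoc⟩ := associated_pow_of_norm_eq_pow_of_inert hp (2 * j) x
        (by rw [hxn]; push_cast; ring)
      obtain rfl : j = j' := by omega
      rw [← primary_of_isPrimary hxp, primary_eq_primary_of_associated hassoc, primary_pow,
        primary_natCast_of_mod_eight hp]
  · ext x
    simp only [Finset.notMem_empty, iff_false]
    intro hx
    obtain ⟨hxn, -⟩ := mem_primaryNormEq.mp hx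
    obtain ⟨j', hj', -⟩ := associated_pow_of_norm_eq_pow_of_inert hp (2 * j + 1) x
      (by rw [hxn]; push_cast; ring)
    omega

/-- **`S(p^{2j}) = (−p)^j` and `S(p^{2j+1}) = 0` for `p ≡ 5, 7 (mod 8)`** (the Euler factor `(1 + p^{1−2s})⁻¹`).
[cite: IrelandRosen1990, Ch. 18 §6, proof of Theorem 7 (analogue)] [cite: Silverberg2010, Thm. 2.7] -/
theorem primarySum_pow_of_inert {p : ℕ} [Fact p.Prime] (hp : p % 8 = 5 ∨ p % 8 = 7) (j : ℕ) :
    primarySum (p ^ (2 * j)) = (-(p : (ℤ√(-2)))) ^ j ∧ primarySum (p ^ (2 * j + 1)) = 0 := by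
  obtain ⟨h1, h2⟩ := primaryNormEq_pow_of_inert hp j
  simp [primarySum, h1, h2]

/-! ### Split primes `p ≡ 1, 3 (mod 8)` -/

/-- **`π` and `π̄` are not associated** when `N(π) = p` is an odd prime (`p` splits into two distinct primes of `ℤ[√-2]`).
[cite: IrelandRosen1990, Ch. 18 §6, proof of Theorem 7 (analogue)] -/
theorem not_dvd_star_of_norm_eq_prime {π : (ℤ√(-2))} {p : ℕ} (hp : p.Prime) (hp2 : p ≠ 2)
    (h : π.norm = p) : ¬ π ∣ star π := by
  rintro ⟨c, hc⟩
  have hp0 : (p : ℤ) ≠ 0 := by exact_mod_cast hp.ne_zero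
  have hn := congrArg Zsqrtd.norm hc
  rw [Zsqrtd.norm_conj, Zsqrtd.norm_mul, h] at hn
  have hc1 : c.norm = 1 := (mul_right_inj' hp0).mp (by rw [← hn, mul_one])
  have hcu : IsUnit c := (Zsqrtd.norm_eq_one_iff' (by norm_num) c).mp hc1
  obtain ⟨a, b⟩ := π
  have hpab : (p : ℤ) = a * a + 2 * (b * b) := by rw [← h, norm_def']
  have hre := congrArg Zsqrtd.re hc
  have him := congrArg Zsqrtd.im hc
  rcases eq_of_isUnit hcu with rfl | rfl <;>
    simp only [Zsqrtd.re_star, Zsqrtd.im_star, mul_one, mul_neg, Zsqrtd.re_neg, Zsqrtd.im_neg] at hre him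
  · -- `c = 1`: `b = 0`, `p = a²`
    have hb : b = 0 := by omega
    subst hb
    apply GaussianPrimary.not_prime_mul_self a.natAbs
    have : a.natAbs * a.natAbs = p := by
      zify
      rw [abs_mul_abs_self]
      linarith
    rw [this]
    exact hp
  · -- `c = −1`: `a = 0`, `p = 2b²`
    have ha : a = 0 := by omega
    subst ha
    have h2 : (2 : ℕ) ∣ p := by
      refine Int.natCast_dvd_natCast.mp ⟨b * b, ?_⟩
      rw [hpab]; ring
    exact hp2 ((hp.eq_one_or_self_of_dvd 2 h2).resolve_left (by decide)).symm

/-- `p = π π̄` in `ℤ[√-2]` when `N(π) = p`. [cite: IrelandRosen1990, Ch. 1, Ex. 36] -/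
theorem natCast_eq_mul_star {π : (ℤ√(-2))} {p : ℕ} (h : π.norm = p) : (p : (ℤ√(-2))) = π * star π := by
  rw [← cast_norm_eq, h, Int.cast_natCast]

/-- **Elements of norm `p^k` at a split prime**: `x = u π^j π̄^{k−j}` with `u` a unit (unique factorisation in `ℤ[√-2]`).
[cite: IrelandRosen1990, Ch. 18 §6, proof of Theorem 7 (analogue)] -/
theorem associated_pow_mul_pow_of_norm_eq_pow {π : (ℤ√(-2))} {p : ℕ} (hp : p.Prime) (h : π.norm = p)
    (k : ℕ) (x : (ℤ√(-2))) (hx : x.norm = (p : ℤ) ^ k) :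
    ∃ j ≤ k, Associated x (π ^ j * star π ^ (k - j)) := by
  have hprime := prime_of_norm_eq_prime hp h
  have hp0 : (p : ℤ) ≠ 0 := by exact_mod_cast hp.ne_zero
  induction k generalizing x with
  | zero =>
    refine ⟨0, le_rfl, ?_⟩
    rw [pow_zero, Nat.sub_zero, pow_zero, mul_one, associated_one_iff_isUnit,
      ← Zsqrtd.norm_eq_one_iff' (by norm_num) x, hx, pow_zero]
  | succ k ih =>
    have hdvd : π ∣ x * star x := by
      rw [← cast_norm_eq, hx]
      push_cast
      rw [natCast_eq_mul_star h]
      exact dvd_pow (dvd_mul_right π (star π)) (Nat.succ_ne_zero k)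
    rcases hprime.dvd_or_dvd hdvd with hπx | hπx
    · obtain ⟨x', rfl⟩ := hπx
      have hx' : x'.norm = (p : ℤ) ^ k := by
        rw [Zsqrtd.norm_mul, h, pow_succ, mul_comm ((p : ℤ) ^ k)] at hx
        exact mul_left_cancel₀ hp0 hx
      obtain ⟨j, hj, hassoc⟩ := ih x' hx'
      refine ⟨j + 1, by omega, ?_⟩
      rw [show k + 1 - (j + 1) = k - j by omega, pow_succ,
        show π ^ j * π * star π ^ (k - j) = π * (π ^ j * star π ^ (k - j)) by ring]
      exact (Associated.refl π).mul_mul hassoc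
    · have hσx : star π ∣ x := by
        obtain ⟨c, hc⟩ := hπx
        refine ⟨star c, ?_⟩
        have := congrArg star hc
        rwa [star_star, star_mul, mul_comm] at this
      obtain ⟨x', rfl⟩ := hσx
      have hx' : x'.norm = (p : ℤ) ^ k := by
        rw [Zsqrtd.norm_mul, Zsqrtd.norm_conj, h, pow_succ, mul_comm ((p : ℤ) ^ k)] at hx
        exact mul_left_cancel₀ hp0 hx
      obtain ⟨j, hj, hassoc⟩ := ih x' hx'
      refine ⟨j, by omega, ?_⟩
      rw [show k + 1 - j = (k - j) + 1 by omega, pow_succ,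
        show π ^ j * (star π ^ (k - j) * star π) = star π * (π ^ j * star π ^ (k - j)) by ring]
      exact (Associated.refl (star π)).mul_mul hassoc

/-- `j ↦ π^j π̄^{k−j}` is injective on `0 ≤ j ≤ k` (as `π ∤ π̄`). [cite: IrelandRosen1990, Ch. 18 §6, proof of Theorem 7 (analogue)] -/
theorem injOn_pow_mul_pow {π : (ℤ√(-2))} {p : ℕ} (hp : p.Prime) (hp2 : p ≠ 2) (h : π.norm = p)
    (k : ℕ) : Set.InjOn (fun j : ℕ ↦ π ^ j * star π ^ (k - j)) (Finset.range (k + 1) : Set ℕ) := by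
  have hprime := prime_of_norm_eq_prime hp h
  have hns := not_dvd_star_of_norm_eq_prime hp hp2 h
  have key : ∀ j₁ j₂ : ℕ, j₂ ≤ k → j₁ < j₂ →
      π ^ j₁ * star π ^ (k - j₁) ≠ π ^ j₂ * star π ^ (k - j₂) := by
    intro j₁ j₂ hj₂ hlt heq
    rw [show j₂ = j₁ + (j₂ - j₁) by omega, pow_add, mul_assoc] at heq
    have heq' := mul_left_cancel₀ (pow_ne_zero _ hprime.ne_zero) heq
    have hdvd : π ∣ star π ^ (k - j₁) := by
      rw [heq']
      exact dvd_mul_of_dvd_left (dvd_pow_self π (by omega)) _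
    exact hns (hprime.dvd_of_dvd_pow hdvd)
  intro j₁ hj₁ j₂ hj₂ heq
  simp only [Finset.coe_range, Set.mem_Iio] at hj₁ hj₂
  rcases lt_trichotomy j₁ j₂ with hlt | rfl | hgt
  · exact absurd heq (key j₁ j₂ (by omega) hlt)
  · rfl
  · exact absurd heq.symm (key j₂ j₁ (by omega) hgt)

/-- **Primary elements of norm `p^k` at a split prime `p = π π̄`**, `π` primary: exactly the `π^j π̄^{k−j}`, `0 ≤ j ≤ k`.
[cite: IrelandRosen1990, Ch. 18 §6, proof of Theorem 7 (analogue)] [cite: Silverberg2010, Thm. 2.7] -/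
theorem primaryNormEq_pow_of_split {π : (ℤ√(-2))} {p : ℕ} (hp : p.Prime)
    (hπ : IsPrimary π) (h : π.norm = p) (k : ℕ) :
    primaryNormEq (p ^ k) = (Finset.range (k + 1)).image fun j ↦ π ^ j * star π ^ (k - j) := by
  ext x
  rw [mem_primaryNormEq, Finset.mem_image]
  constructor
  · rintro ⟨hxn, hxp⟩
    obtain ⟨j, hj, hassoc⟩ := associated_pow_mul_pow_of_norm_eq_pow hp h k x
      (by rw [hxn]; push_cast; ring)
    refine ⟨j, Finset.mem_range.mpr (by omega), ?_⟩
    rw [← primary_of_isPrimary hxp, primary_eq_of_associated hassoc ((hπ.pow j).mul (hπ.star.pow _))]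
  · rintro ⟨j, hj, rfl⟩
    refine ⟨?_, (hπ.pow j).mul (hπ.star.pow _)⟩
    rw [Finset.mem_range] at hj
    rw [Zsqrtd.norm_mul, norm_pow', norm_pow', Zsqrtd.norm_conj, h, ← pow_add,
      show j + (k - j) = k by omega]
    push_cast
    ring

/-- **`S(p^k) = ∑_{j=0}^{k} π^j π̄^{k−j}` at a split prime** (`p` odd, `p = N(π)`, `π` primary).
[cite: IrelandRosen1990, Ch. 18 §6, proof of Theorem 7 (analogue)] [cite: Silverberg2010, Thm. 2.7] -/
theorem primarySum_pow_of_split {π : (ℤ√(-2))} {p : ℕ} (hp : p.Prime) (hp2 : p ≠ 2)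
    (hπ : IsPrimary π) (h : π.norm = p) (k : ℕ) :
    primarySum (p ^ k) = ∑ j ∈ Finset.range (k + 1), π ^ j * star π ^ (k - j) := by
  rw [primarySum, primaryNormEq_pow_of_split hp hπ h k, Finset.sum_image (injOn_pow_mul_pow hp hp2 h k)]

/-- **Fermat: a prime `p ≡ 1, 3 (mod 8)` is a norm from `ℤ[√-2]`, `p = a² + 2b²`** — with `a + b√-2` PRIMARY.  `−2` is a square
mod `p` (the supplement `ZMod.exists_sq_eq_neg_two_iff`), so `p ∣ c² + 2 = (c + √-2)(c − √-2)` for some `c ∈ ℤ`; `p` divides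
neither factor, hence is not prime in the UFD `ℤ[√-2]`, hence `p = N(x)` for a non-unit proper divisor `x`; pass to the primary
associate. [cite: IrelandRosen1990, Ch. 5 §1 and Ch. 1 Ex. 36] [cite: Silverberg2010, Thm. 2.7] -/
theorem exists_isPrimary_norm_eq {p : ℕ} [hpp : Fact p.Prime] (hp : p % 8 = 1 ∨ p % 8 = 3) :
    ∃ π : (ℤ√(-2)), IsPrimary π ∧ π.norm = p := by
  have hP : p.Prime := hpp.out
  have hp2 : p ≠ 2 := by rintro rfl; norm_num at hp
  -- `−2 ≡ c² (mod p)`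
  obtain ⟨c0, hc0⟩ := (ZMod.exists_sq_eq_neg_two_iff hp2).mpr hp
  obtain ⟨c, rfl⟩ := ZMod.intCast_surjective c0
  have hcp : (p : ℤ) ∣ c * c + 2 := by
    rw [← ZMod.intCast_zmod_eq_zero_iff_dvd]
    push_cast
    rw [← hc0]; ring
  -- `p ∣ (c + √-2)(c − √-2)` in `ℤ[√-2]`, but divides neither factor
  have hdvd : (p : (ℤ√(-2))) ∣ (⟨c, 1⟩ : (ℤ√(-2))) * ⟨c, -1⟩ := by
    obtain ⟨t, ht⟩ := hcp
    refine ⟨t, Zsqrtd.ext ?_ ?_⟩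
    · simp only [Zsqrtd.re_mul, Zsqrtd.re_natCast, Zsqrtd.re_intCast, Zsqrtd.im_natCast]
      linarith [ht]
    · simp [Zsqrtd.im_mul]
  have hndvd : ∀ s : ℤ, ¬ (p : (ℤ√(-2))) ∣ (⟨c, s⟩ : (ℤ√(-2))) ∨ s = 0 ∨ (p : ℤ) ∣ s := by
    intro s
    by_cases hs : (p : ℤ) ∣ s
    · exact Or.inr (Or.inr hs)
    · left
      rintro ⟨t, ht⟩
      have := congrArg Zsqrtd.im ht
      simp only [Zsqrtd.im_mul, Zsqrtd.re_natCast, Zsqrtd.im_natCast, zero_mul, add_zero] at this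
      exact hs ⟨t.im, this⟩
  have hp1 : ¬ (p : ℤ) ∣ 1 := fun h1 ↦ hP.ne_one (by exact_mod_cast Int.eq_one_of_dvd_one (by positivity) h1)
  have hn1 : ¬ (p : (ℤ√(-2))) ∣ (⟨c, 1⟩ : (ℤ√(-2))) := by
    rcases hndvd 1 with h | h | h
    · exact h
    · exact absurd h one_ne_zero
    · exact absurd h hp1
  have hn2 : ¬ (p : (ℤ√(-2))) ∣ (⟨c, -1⟩ : (ℤ√(-2))) := by
    rcases hndvd (-1) with h | h | h
    · exact h
    · exact absurd h (by norm_num)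
    · exact absurd ((dvd_neg).mp h) hp1
  have hnotprime : ¬ Prime (p : (ℤ√(-2))) := fun hpr ↦ by
    rcases hpr.dvd_or_dvd hdvd with h | h
    · exact hn1 h
    · exact hn2 h
  have hnotirr : ¬ Irreducible (p : (ℤ√(-2))) := fun hirr ↦ hnotprime hirr.prime
  have hp0 : (p : (ℤ√(-2))) ≠ 0 := by exact_mod_cast hP.ne_zero
  have hnu : ¬ IsUnit (p : (ℤ√(-2))) := by
    intro hu
    have := (Zsqrtd.norm_eq_one_iff' (by norm_num) (p : (ℤ√(-2)))).mpr hu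
    rw [Zsqrtd.norm_natCast] at this
    have h2 : (2 : ℤ) ≤ p := by exact_mod_cast hP.two_le
    nlinarith
  rw [irreducible_iff] at hnotirr
  simp only [not_and, not_forall, not_or] at hnotirr
  obtain ⟨a, b, hab, ha, hb⟩ := hnotirr hnu
  -- `N(a) N(b) = p²` with neither norm `1`: `N(a) = p`
  have hn := congrArg Zsqrtd.norm hab
  rw [Zsqrtd.norm_natCast, Zsqrtd.norm_mul] at hn
  have ha1 : a.norm ≠ 1 := fun h1 ↦ ha ((Zsqrtd.norm_eq_one_iff' (by norm_num) a).mp h1)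
  have hb1 : b.norm ≠ 1 := fun h1 ↦ hb ((Zsqrtd.norm_eq_one_iff' (by norm_num) b).mp h1)
  have ha0 := norm_nonneg' a
  have hb0 := norm_nonneg' b
  have hn' : a.norm.natAbs * b.norm.natAbs = p ^ 2 := by
    have := congrArg Int.natAbs hn
    rwa [Int.natAbs_mul, Int.natAbs_mul, Int.natAbs_natCast, eq_comm, ← pow_two] at this
  have hdvda : a.norm.natAbs ∣ p ^ 2 := Dvd.intro _ hn'
  obtain ⟨i, hi, hai⟩ := (Nat.dvd_prime_pow hP).mp hdvda
  have hna : a.norm = p := by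
    interval_cases i
    · exfalso; rw [pow_zero] at hai; exact ha1 (by rw [← Int.natAbs_of_nonneg ha0, hai]; rfl)
    · rw [← Int.natAbs_of_nonneg ha0, hai, pow_one]
    · exfalso
      rw [hai] at hn'
      have hpp0 : 0 < p ^ 2 := Nat.pos_of_ne_zero (pow_ne_zero 2 hP.ne_zero)
      have : b.norm.natAbs = 1 := Nat.eq_of_mul_eq_mul_left hpp0 (hn'.trans (mul_one _).symm)
      exact hb1 (by rw [← Int.natAbs_of_nonneg hb0, this]; rfl)
  have hodd : a.re % 2 = 1 := by
    rw [← norm_emod_two, hna]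
    rcases hp with h | h <;> omega
  exact ⟨primary a, isPrimary_primary hodd, by rw [norm_primary hodd, hna]⟩

end SqrtNegTwoPrimary

end Literature.NumberTheory.QuadraticFields
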